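import Summits.BirchSwinnertonDyer.BirchSwinnertonDyer.Theorems.AdditiveKolyvaginRoadRamifiedHabitatPStarTwistPotMult
import HarnessLib

/-!
# Route `AdditiveKolyvaginRoad`, crux KS′ `LevelKolyvaginSystemsAdditive` (stmt-BirchSwinnertonDyer-21396), card `ramified-toric-habitat` —
# part 11: the additive POTENTIALLY MULTIPLICATIVE row of the habitat — the sign DEPENDS ON `d'`, assuming only the Modularity Theorem

Cell `pub/bsd-wall`, width seat `bsd-wall-akr-p2x-w2` g11; `--supports stmt-BirchSwinnertonDyer-21396` (helper). THEOREMS ONLY; no definition,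
no named fact, no `sorry`. BSD is not proved by any of this; KS′/KPA′ stay OPEN at `p² ∣ N`.

* `rootNumber_mul_rootNumber_pStarTwist_eq_legendreSym_mul_of_mult` — Atkin–Lehner-formal: `w(E)·w(E') = (M/p)·λ_p(f)·λ_p(f')` for `N = M p²`,
  `N' = M p` (`M` squarefree);
* `rootNumber_mul_rootNumber_pStarTwist_of_potMult` — `w(E)·w(E^{(p*)}) = (M/p)·(−1/p)·W_p(E^{(p*)})`, both eigenvalues at `p` being local root
  numbers by THEOREMS of the tree (`atkinLehnerEigenvalueAt_eq_localRootNumberAt_of_twist` for the twist-type prime of `E`,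
  `…_of_not_sq_dvd` for the multiplicative prime of `E^{(p*)}`), so only `exists_isNewformOf` is assumed;
* `rootNumber_mul_rootNumber_ramifiedTwist_of_potMult` — in the habitat (`d = p*·d'`, `d' ≡ 1 (4)` squarefree prime to `N`, `d < 0`, other bad
  primes split): **`w(E)·w(E^{(d)}) = −(d'/p)·W_p(E^{(p*)})`**. For fixed `E` this FLIPS with `(d'/p)` (`E = 11a1^{(−11)}`: `d = −11` vs `−143`),
  so the sketch's `SignLawPrincipalSeries` («= −1») cannot hold on the potentially multiplicative rows — the datum of evidence #41 as a theorem
  about the product (repair: add «potentially good at p», under which parts 3–9 give the law).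

References: [cite: MurtyMurty1997, Ch. 6 §1] [cite: Rohrlich1993Compositio, Prop. 2(ii),(iii)] [cite: KellockDokchitser2023, Rem. 2.2 and Thm. 2.3]
[cite: Knapp1993, Thm. 9.27].
-/

set_option autoImplicit false
set_option linter.dupNamespace false

noncomputable section

open scoped Classical MatrixGroups

open CongruenceSubgroup IsDedekindDomain IsDedekindDomain.HeightOneSpectrum NumberField Rat.HeightOneSpectrum
  WeierstrassCurve Literature.NumberTheory.EllipticCurves Literature.NumberTheory.EllipticCurves.ModularForms
  IsDiscreteValuationRing

namespace Summit.BirchSwinnertonDyer.BirchSwinnertonDyer.Theorems.AdditiveKoly.RamifiedHabitat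

section PotMult

open scoped NumberTheorySymbols

variable {p : ℕ} [Fact p.Prime]

/-- **`w(E)·w(E') = (M/p)·λ_p(f)·λ_p(f')` when `N_E = M p²` and `N_{E'} = M p`** (`E' = E^{(p*)}` multiplicative at `p`, `M` squarefree):
Atkin–Lehner-formal off `p`, as in parts 2 and 8. [cite: Knapp1993, Thm. 9.27] [cite: AtkinLehner1970, Thm. 3 and §6] -/
theorem rootNumber_mul_rootNumber_pStarTwist_eq_legendreSym_mul_of_mult (W : WeierstrassCurve ℚ) [W.IsElliptic]
    [NeZero (W.conductorNorm ℤ)] (hp2 : p ≠ 2) {M : ℕ} (hN : W.conductorNorm ℤ = M * p ^ 2) (hM : Squarefree M)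
    (hpM : ¬ p ∣ M) [(W.quadraticTwist (((-1 : ℤ) ^ (p / 2) * p : ℤ) : ℚ)).IsElliptic]
    [NeZero ((W.quadraticTwist (((-1 : ℤ) ^ (p / 2) * p : ℤ) : ℚ)).conductorNorm ℤ)]
    (hN' : (W.quadraticTwist (((-1 : ℤ) ^ (p / 2) * p : ℤ) : ℚ)).conductorNorm ℤ = M * p)
    {f : CuspForm (Gamma0 (W.conductorNorm ℤ)) 2} (hf : IsNewformOf W f)
    {f' : CuspForm (Gamma0 ((W.quadraticTwist (((-1 : ℤ) ^ (p / 2) * p : ℤ) : ℚ)).conductorNorm ℤ)) 2}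
    (hf' : IsNewformOf (W.quadraticTwist (((-1 : ℤ) ^ (p / 2) * p : ℤ) : ℚ)) f') :
    ((W.rootNumber * (W.quadraticTwist (((-1 : ℤ) ^ (p / 2) * p : ℤ) : ℚ)).rootNumber : ℤ) : ℂ) =
      legendreSym p M * (atkinLehnerEigenvalueAt f p * atkinLehnerEigenvalueAt f' p) := by
  have hp : p.Prime := Fact.out
  have hw : (W.rootNumber : ℂ) = -frickeEigenvalue f :=
    Literature.NumberTheory.EllipticCurves.rootNumber_eq_neg_of_frickeInvolution_eq_smul W hf
      (IsNewform0.frickeEigenvalue_eq_one_or_eq_neg_one_holds hf.1) (IsNewform0.frickeInvolution_eq_smul_holds hf.1)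
  have hw' : ((W.quadraticTwist (((-1 : ℤ) ^ (p / 2) * p : ℤ) : ℚ)).rootNumber : ℂ) = -frickeEigenvalue f' :=
    Literature.NumberTheory.EllipticCurves.rootNumber_eq_neg_of_frickeInvolution_eq_smul _ hf'
      (IsNewform0.frickeEigenvalue_eq_one_or_eq_neg_one_holds hf'.1) (IsNewform0.frickeInvolution_eq_smul_holds hf'.1)
  have hε := IsNewform0.frickeEigenvalue_eq_prod_atkinLehnerEigenvalueAt_holds hf.1
  have hε' := IsNewform0.frickeEigenvalue_eq_prod_atkinLehnerEigenvalueAt_holds hf'.1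
  have hM0 : M ≠ 0 := hM.ne_zero
  have hpf : (W.conductorNorm ℤ).primeFactors = insert p M.primeFactors := by
    rw [hN, Nat.primeFactors_mul hM0 (pow_ne_zero 2 hp.ne_zero), Nat.primeFactors_pow _ two_ne_zero, hp.primeFactors,
      Finset.union_comm]
    rfl
  have hpf' : ((W.quadraticTwist (((-1 : ℤ) ^ (p / 2) * p : ℤ) : ℚ)).conductorNorm ℤ).primeFactors = insert p M.primeFactors := by
    rw [hN', Nat.primeFactors_mul hM0 hp.ne_zero, hp.primeFactors, Finset.union_comm]
    rfl
  have hpnot : p ∉ M.primeFactors := fun h ↦ hpM (Nat.dvd_of_mem_primeFactors h)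
  have hq : ∀ q ∈ M.primeFactors, atkinLehnerEigenvalueAt f q * atkinLehnerEigenvalueAt f' q = legendreSym p q := by
    intro q hqM
    have hqp : q.Prime := Nat.prime_of_mem_primeFactors hqM
    haveI := Fact.mk hqp
    have hqdM : q ∣ M := Nat.dvd_of_mem_primeFactors hqM
    have hqnep : q ≠ p := fun h ↦ hpnot (h ▸ hqM)
    have hpq : ¬ p ∣ q := fun h ↦ hqnep ((Nat.prime_dvd_prime_iff_eq hp hqp).mp h).symm
    obtain ⟨M₁, hM₁⟩ := hqdM
    have hqM₁ : ¬ q ∣ M₁ := by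
      rintro ⟨M₂, rfl⟩
      exact hqp.one_lt.ne' (Nat.isUnit_iff.mp (hM q ⟨M₂, by rw [hM₁]; ring⟩))
    have hqrest : ¬ q ∣ M₁ * p ^ 2 := by
      intro h
      rcases (Nat.Prime.dvd_mul hqp).mp h with h | h
      · exact hqM₁ h
      · exact hqnep ((Nat.prime_dvd_prime_iff_eq hqp hp).mp (hqp.dvd_of_dvd_pow h))
    have hqrest' : ¬ q ∣ M₁ * p := by
      intro h
      rcases (Nat.Prime.dvd_mul hqp).mp h with h | h
      · exact hqM₁ h
      · exact hqnep ((Nat.prime_dvd_prime_iff_eq hqp hp).mp h)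
    have hNq : W.conductorNorm ℤ = q * (M₁ * p ^ 2) := by rw [hN, hM₁]; ring
    have hNq' : (W.quadraticTwist (((-1 : ℤ) ^ (p / 2) * p : ℤ) : ℚ)).conductorNorm ℤ = q * (M₁ * p) := by rw [hN', hM₁]; ring
    have h1 : atkinLehnerEigenvalueAt f q = -cuspCoeff f q :=
      hf.1.atkinLehnerEigenvalueAt_eq_neg_coeff_of_not_dvd q hNq hqrest
    have h2 : atkinLehnerEigenvalueAt f' q = -cuspCoeff f' q :=
      hf'.1.atkinLehnerEigenvalueAt_eq_neg_coeff_of_not_dvd q hNq' hqrest'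
    have h3 : cuspCoeff f' q = legendreSym p q * cuspCoeff f q := by
      rw [hf.2 q, hf'.2 q, W.LFunction_quadraticTwist_pStar_apply hp2 hpq]
      push_cast
      ring
    have h1' : cuspCoeff f q = -atkinLehnerEigenvalueAt f q := by rw [h1, neg_neg]
    have h4 : atkinLehnerEigenvalueAt f q * atkinLehnerEigenvalueAt f q = 1 := by
      rcases hf.1.atkinLehnerEigenvalueAt_eq_one_or_eq_neg_one hqp (hNq ▸ dvd_mul_right q _) with h | h <;>
        rw [h] <;> norm_num
    calc atkinLehnerEigenvalueAt f q * atkinLehnerEigenvalueAt f' q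
        = legendreSym p q * (atkinLehnerEigenvalueAt f q * atkinLehnerEigenvalueAt f q) := by
          rw [h2, h3, h1']; ring
      _ = legendreSym p q := by rw [h4, mul_one]
  have hleg : ∏ q ∈ M.primeFactors, (legendreSym p q : ℂ) = legendreSym p M := by
    conv_rhs => rw [← Nat.prod_primeFactors_of_squarefree hM]
    rw [Nat.cast_prod, ← legendreSym.hom_apply, map_prod]
    push_cast
    simp only [legendreSym.hom_apply]
  rw [Int.cast_mul, hw, hw', hε, hε', hpf, hpf', Finset.prod_insert hpnot, Finset.prod_insert hpnot, neg_mul_neg,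
    mul_mul_mul_comm, ← Finset.prod_mul_distrib, Finset.prod_congr rfl hq, hleg]
  ring

/-- **POTENTIALLY MULTIPLICATIVE `p`: `w(E)·w(E^{(p*)}) = (M/p)·(−1/p)·W_p(E^{(p*)})`, assuming only the Modularity Theorem.** `E/ℚ` of conductor
`N = M p²` (`p ≥ 5`, `M` squarefree, `p ∤ M`) whose minimal model at `p` has `ord_p c₄ = 2`, `ord_p Δ = a > 6` (additive, potentially
multiplicative). Then `E' = E^{(p*)}` is MULTIPLICATIVE at `p`, `N_{E'} = M p`, and both Atkin–Lehner eigenvalues at `p` are local root numbers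
by THEOREMS of the tree (`…_of_twist` for `E`, `…_of_not_sq_dvd` for `E'`): `w(E)·w(E') = (M/p)·(−1/p)·W_p(E')`, with `W_p(E') = −1`
(split) or `+1` (non-split). [cite: KellockDokchitser2023, Rem. 2.2 and Thm. 2.3] [cite: Rohrlich1993Compositio, Prop. 2(ii),(iii)] -/
theorem rootNumber_mul_rootNumber_pStarTwist_of_potMult (W : WeierstrassCurve ℚ) [W.IsElliptic] (hmod : exists_isNewformOf) (hp5 : 5 ≤ p)
    {M : ℕ} (hN : W.conductorNorm ℤ = M * p ^ 2) (hM : Squarefree M) (hpM : ¬ p ∣ M) {a : ℕ}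
    (hΔ : addVal ℤ_[p] (((W.baseChange ℚ_[p]).minimal ℤ_[p]).integralModel ℤ_[p]).Δ = a) (ha : 6 < a)
    (hc₄ : addVal ℤ_[p] (((W.baseChange ℚ_[p]).minimal ℤ_[p]).integralModel ℤ_[p]).c₄ = 2) :
    W.rootNumber * (W.quadraticTwist (((-1 : ℤ) ^ (p / 2) * p : ℤ) : ℚ)).rootNumber =
      legendreSym p M * ZMod.χ₄ p *
        ((W.quadraticTwist (((-1 : ℤ) ^ (p / 2) * p : ℤ) : ℚ)).baseChange ℚ_[p]).localRootNumber ℤ_[p] := by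
  have hp : p.Prime := Fact.out
  have hp2 : p ≠ 2 := by omega
  have hdZ0 : ((-1 : ℤ) ^ (p / 2) * p : ℤ) ≠ 0 :=
    mul_ne_zero (pow_ne_zero _ (by norm_num)) (by exact_mod_cast hp.ne_zero)
  have hd0 : (((((-1 : ℤ) ^ (p / 2) * p : ℤ)) : ℚ)) ≠ 0 := by exact_mod_cast hdZ0
  haveI hE' : (W.quadraticTwist (((-1 : ℤ) ^ (p / 2) * p : ℤ) : ℚ)).IsElliptic := W.isElliptic_quadraticTwist hd0
  haveI : NeZero (W.conductorNorm ℤ) := ⟨(W.conductorNorm_pos_holds).ne'⟩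
  haveI : NeZero ((W.quadraticTwist (((-1 : ℤ) ^ (p / 2) * p : ℤ) : ℚ)).conductorNorm ℤ) :=
    ⟨((W.quadraticTwist _).conductorNorm_pos_holds).ne'⟩
  obtain ⟨hadd, hmult, hroot⟩ := hasMultiplicativeReduction_pStarTwist_padic_of_potMult W hp5 hΔ ha hc₄
  have hN' := conductorNorm_pStarTwist_eq_mul_of_mult W hp5 hN hpM hmult
  obtain ⟨f, hf⟩ := hmod W
  obtain ⟨f', hf'⟩ := hmod (W.quadraticTwist (((-1 : ℤ) ^ (p / 2) * p : ℤ) : ℚ))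
  have h0 := rootNumber_mul_rootNumber_pStarTwist_eq_legendreSym_mul_of_mult W hp2 hN hM hpM hN' hf hf'
  set P : Nat.Primes := ⟨p, hp⟩ with hP
  have haddZ : W.HasAdditiveReductionAt ((primesEquiv (R := ℤ)).symm P) :=
    (W.hasAdditiveReduction_padic_iff_hasAdditiveReductionAt_int P).mp hadd
  have hsemi : ¬ (W.quadraticTwist (((-1 : ℤ) ^ ((P : ℕ) / 2) * P : ℤ) : ℚ)).HasAdditiveReductionAt
      ((primesEquiv (R := ℤ)).symm P) := fun h ↦
    (((W.quadraticTwist _).hasAdditiveReduction_padic_iff_hasAdditiveReductionAt_int P).mpr h).not_hasMultiplicativeReduction _ hmult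
  have h23 : ∀ v : HeightOneSpectrum ℤ, W.HasAdditiveReductionAt v → 3 < ringChar (ℤ ⧸ v.asIdeal) := by
    intro v hv
    rw [Rat.ringChar_int_quotient_asIdeal]
    have h2 := (two_le_conductorExponent_iff_holds v W).mpr hv
    rw [← factorization_conductorNorm_holds W v, hN] at h2
    set q := natGenerator v with hq
    by_contra hle
    have hqp : q ≠ p := by intro h; rw [h] at hle; omega
    rw [Nat.factorization_mul hM.ne_zero (pow_ne_zero 2 hp.ne_zero), Finsupp.add_apply, Nat.factorization_pow, Finsupp.smul_apply,
      hp.factorization, Finsupp.single_eq_of_ne hqp, smul_zero, add_zero] at h2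
    have h1 := (Nat.squarefree_iff_factorization_le_one hM.ne_zero).mp hM q
    omega
  have hl : atkinLehnerEigenvalueAt f p = ((W.baseChange ℚ_[p]).localRootNumber ℤ_[p] : ℂ) := by
    rw [← localRootNumberAt_primesEquiv_symm_holds W P]
    exact W.atkinLehnerEigenvalueAt_eq_localRootNumberAt_of_twist hmod hf P hp5 haddZ hsemi h23
  have hPN' : (P : ℕ) ∣ (W.quadraticTwist (((-1 : ℤ) ^ (p / 2) * p : ℤ) : ℚ)).conductorNorm ℤ := by
    change p ∣ _; rw [hN']; exact ⟨M, by ring⟩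
  have hPN'2 : ¬ (P : ℕ) ^ 2 ∣ (W.quadraticTwist (((-1 : ℤ) ^ (p / 2) * p : ℤ) : ℚ)).conductorNorm ℤ := by
    change ¬ p ^ 2 ∣ _; rw [hN']
    rintro ⟨k, hk⟩
    apply hpM
    have : M = p * k := by
      have h := hk; rw [sq, mul_assoc] at h
      exact Nat.eq_of_mul_eq_mul_right hp.pos (by rw [mul_comm]; rw [mul_comm p k] ; linarith [h])
    exact ⟨k, this⟩
  have hl' : atkinLehnerEigenvalueAt f' p =
      (((W.quadraticTwist (((-1 : ℤ) ^ (p / 2) * p : ℤ) : ℚ)).baseChange ℚ_[p]).localRootNumber ℤ_[p] : ℂ) := by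
    rw [← localRootNumberAt_primesEquiv_symm_holds _ P]
    exact (W.quadraticTwist _).atkinLehnerEigenvalueAt_eq_localRootNumberAt_of_not_sq_dvd hf' P hPN' hPN'2
  rw [hl, hl', hroot, ← Int.cast_mul] at h0
  have h0' : ((W.rootNumber * (W.quadraticTwist (((-1 : ℤ) ^ (p / 2) * p : ℤ) : ℚ)).rootNumber : ℤ) : ℂ) =
      ((legendreSym p M * (ZMod.χ₄ p * ((W.quadraticTwist (((-1 : ℤ) ^ (p / 2) * p : ℤ) : ℚ)).baseChange ℚ_[p]).localRootNumber ℤ_[p]) : ℤ) : ℂ) := by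
    rw [h0]; push_cast; ring
  have := (Int.cast_injective (α := ℂ)) h0'
  rw [this]; ring

/-- **THE POTENTIALLY MULTIPLICATIVE ROW OF THE HABITAT: the sign DEPENDS ON `d'`.** `E` as in `rootNumber_mul_rootNumber_pStarTwist_of_potMult`;
`d = p*·d'` (`d' ≡ 1 (4)` squarefree prime to `N`, `d < 0`), every prime of `M` split in `ℚ(√d)` (the card's habitat: `p` ramified, `E` additive
at `p` with `semistabilityDefectAt = 2 ∣ p − 1` by the tree's reading). Then, assuming ONLY the Modularity Theorem,
`w(E)·w(E^{(d)}) = −(d'/p)·W_p(E^{(p*)})`: for fixed `E` the sign FLIPS with the class of `d'` mod `p` — so the sketch's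
`SignLawPrincipalSeries` («= −1» for all such `K′`) cannot hold on these rows (evidence #41 on the crux item: `E = 11a1^{(−11)}`, `d = −11` vs
`d = −143`). [cite: MurtyMurty1997, Ch. 6 §1] [cite: Rohrlich1993Compositio, Prop. 2(ii),(iii)] [cite: KellockDokchitser2023, Rem. 2.2] -/
theorem rootNumber_mul_rootNumber_ramifiedTwist_of_potMult (W : WeierstrassCurve ℚ) [W.IsElliptic] (hmod : exists_isNewformOf)
    (hp5 : 5 ≤ p) {M : ℕ} (hN : W.conductorNorm ℤ = M * p ^ 2) (hM : Squarefree M) (hpM : ¬ p ∣ M) {a : ℕ}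
    (hΔ : addVal ℤ_[p] (((W.baseChange ℚ_[p]).minimal ℤ_[p]).integralModel ℤ_[p]).Δ = a) (ha : 6 < a)
    (hc₄ : addVal ℤ_[p] (((W.baseChange ℚ_[p]).minimal ℤ_[p]).integralModel ℤ_[p]).c₄ = 2)
    {d' : ℤ} (hd'4 : d' % 4 = 1) (hd'sq : Squarefree d') (hgcd : Int.gcd d' (W.conductorNorm ℤ) = 1)
    (hneg : (-1 : ℤ) ^ (p / 2) * p * d' < 0)
    (hodd : ∀ q ∈ M.primeFactors, q ≠ 2 → J((-1 : ℤ) ^ (p / 2) * p * d' | q) = 1)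
    (htwo : 2 ∣ M → ((-1 : ℤ) ^ (p / 2) * p * d') % 8 = 1) :
    W.rootNumber * (W.quadraticTwist (((-1 : ℤ) ^ (p / 2) * p * d' : ℤ) : ℚ)).rootNumber =
      -legendreSym p d' * ((W.quadraticTwist (((-1 : ℤ) ^ (p / 2) * p : ℤ) : ℚ)).baseChange ℚ_[p]).localRootNumber ℤ_[p] := by
  have hp : p.Prime := Fact.out
  have hp2 : p ≠ 2 := by omega
  have hdZ0 : ((-1 : ℤ) ^ (p / 2) * p : ℤ) ≠ 0 :=
    mul_ne_zero (pow_ne_zero _ (by norm_num)) (by exact_mod_cast hp.ne_zero)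
  have hd0 : (((((-1 : ℤ) ^ (p / 2) * p : ℤ)) : ℚ)) ≠ 0 := by exact_mod_cast hdZ0
  haveI hE' : (W.quadraticTwist (((-1 : ℤ) ^ (p / 2) * p : ℤ) : ℚ)).IsElliptic := W.isElliptic_quadraticTwist hd0
  have hA := rootNumber_mul_rootNumber_pStarTwist_of_potMult W hmod hp5 hN hM hpM hΔ ha hc₄
  obtain ⟨-, hmult, -⟩ := hasMultiplicativeReduction_pStarTwist_padic_of_potMult W hp5 hΔ ha hc₄
  have hN' := conductorNorm_pStarTwist_eq_mul_of_mult W hp5 hN hpM hmult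
  have hgcd' : Int.gcd d' ((W.quadraticTwist (((-1 : ℤ) ^ (p / 2) * p : ℤ) : ℚ)).conductorNorm ℤ) = 1 := by
    rw [hN']
    have h1 := Int.isCoprime_iff_gcd_eq_one.mpr hgcd
    rw [hN] at h1
    push_cast at h1 ⊢
    rw [sq, ← mul_assoc] at h1
    exact Int.isCoprime_iff_gcd_eq_one.mp h1.of_mul_right_left
  have hB := ((W.quadraticTwist (((-1 : ℤ) ^ (p / 2) * p : ℤ) : ℚ)).rootNumber_quadraticTwist_of_emod_four_eq_one
    hmod hd'4 hd'sq hgcd').1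
  rw [quadraticTwist_quadraticTwist, hN'] at hB
  have hcast : ((((-1 : ℤ) ^ (p / 2) * p : ℤ) : ℚ)) * (d' : ℚ) = (((-1 : ℤ) ^ (p / 2) * p * d' : ℤ) : ℚ) := by push_cast; ring
  rw [hcast] at hB
  have hNe0 : NeZero d'.natAbs := ⟨Int.natAbs_ne_zero.mpr (by rintro rfl; norm_num at hd'4)⟩
  -- `(M p / |d'|) = (M/p)·(d'/p)`
  have hpodd : Odd p := (Nat.Prime.eq_two_or_odd' hp).resolve_left hp2
  have hJM : J(((M * p : ℕ) : ℤ) | d'.natAbs) = legendreSym p M * legendreSym p d' := by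
    rw [Nat.cast_mul, jacobiSym.mul_left, jacobiSym_natAbs_eq_legendreSym_of_split hp2 hd'4 hM hodd htwo,
      Literature.NumberTheory.QuadraticFields.jacobiSym_natAbs_eq_of_emod_four_eq_one hd'4 hpodd, ← jacobiSym.legendreSym.to_jacobiSym]
  have hJ1 := jacobiSym_neg_one_natAbs_eq_of_neg hp2 hd'4 hneg
  have hM2 : legendreSym p M * legendreSym p M = 1 := by
    rw [← sq]
    refine legendreSym.sq_one p ?_
    rw [Int.cast_natCast, ne_eq, ZMod.natCast_eq_zero_iff]
    exact hpM
  have hχ₄ : ZMod.χ₄ p * ZMod.χ₄ p = 1 := by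
    have hp' := (Nat.Prime.eq_two_or_odd hp).resolve_left hp2
    rw [ZMod.χ₄_nat_eq_if_mod_four]
    have : p % 4 = 1 ∨ p % 4 = 3 := by omega
    have h2' : p % 2 ≠ 0 := by omega
    rcases this with h | h <;> simp [h, h2']
  set w' := ((W.quadraticTwist (((-1 : ℤ) ^ (p / 2) * p : ℤ) : ℚ)).baseChange ℚ_[p]).localRootNumber ℤ_[p]
  calc W.rootNumber * (W.quadraticTwist (((-1 : ℤ) ^ (p / 2) * p * d' : ℤ) : ℚ)).rootNumber
      = J(-1 | d'.natAbs) * J(((M * p : ℕ) : ℤ) | d'.natAbs) *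
          (W.rootNumber * (W.quadraticTwist (((-1 : ℤ) ^ (p / 2) * p : ℤ) : ℚ)).rootNumber) := by rw [hB]; ring
    _ = -ZMod.χ₄ p * (legendreSym p M * legendreSym p d') * (legendreSym p M * ZMod.χ₄ p * w') := by rw [hJ1, hJM, hA]
    _ = -legendreSym p d' * w' := by
        linear_combination (-(legendreSym p d') * w' * (ZMod.χ₄ p * ZMod.χ₄ p)) * hM2 - (legendreSym p d' * w') * hχ₄

end PotMult

end Summit.BirchSwinnertonDyer.BirchSwinnertonDyer.Theorems.AdditiveKoly.RamifiedHabitat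

end
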